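import Summits.QuantumAdvantage.QuantumAdvantage.Theses.CubicForrelation
import Summits.QuantumAdvantage.QuantumAdvantage.Theorems.CubicForrelationNearExactIsExactBentDuality
import Literature.Computability.QuantumComplexity.ForrelationDirectSum
import Literature.Computability.QuantumComplexity.ForrelationSignTransport

/-!
# Crux `CubicForrelation.NearExactIsExact` (stmt-QuantumAdvantage-14043) — line `bent-nonbent-split`
  (crux-strategist `cstrat-stmt-QuantumAdvantage-14043-s1`, 2026-08-17; ALTERNATIVE line, does not touch the lead's
  `Lines/direct_sum_amplification.lean`)

Crux (route `CubicForrelation`, rank 2): `∃ θ < 1, ∀ even n, ∀ cubic f g, Φ(f,g) > θ ⇒ Φ(f,g) = 1`.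

## The line = the bent / non-bent DECOMPOSITION, registered as two CLEAN stubs

This file is the vehicle of the strategist's decomposition (STRATEGY-CENSUS.md §Decomposition; the route-level
`--split` is deferred by the gate to a seat's final cycle). The crux is EQUIVALENT (`nearExactIsExact_iff_stubs`) to the
conjunction of two of its consequences — the two halves of the quadratic sibling's proof (θ = 1/2: a non-bent quadratic is
plateaued; a bent quadratic has a quadratic dual), each of which breaks for cubics at a DIFFERENT obstruction:

* `stub_nearExactBentIsExact` (bent side): `∃ θ < 1`, cubic `f`, cubic BENT `g` (bent ⟺ `∃ d, Φ(d,g) = 1`, see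
  `isBentD_iff_sq`), `Φ > θ ⇒ Φ = 1`.  In distance form (`bentStub_iff_dualDistanceGap`, PROVED from the landed
  `bb_forrelation_eq_of_dual`): THE DUAL OF A CUBIC BENT FUNCTION IS CUBIC, OR AT RELATIVE HAMMING DISTANCE ≥ c FROM EVERY CUBIC,
  for one absolute `c > 0`.  Obstruction it isolates: duals of cubic bent functions have unbounded degree (Hou, `(m+3)/2`,
  attained by Gold-type Maiorana–McFarland functions).  Landed partial results that are literally cases of this stub: MM-shaped
  (`mmShapeCeiling_of_parts`, 31/32), almost-MM (`stub_ammCeiling`, 1 − 2⁻¹⁰), low-rank-spanned partner (`stub_lrdrBand`),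
  `deg g̃ ≤ 11` / m ≤ 20 (`bb_band_of_dual_degree`, `bb_band_of_mid_m`).  The 15/16 witness lives here (θ ≥ 15/16).
* `stub_nearExactIsBent` (non-bent side): `∃ θ < 1`, cubic `f g`, `Φ > θ ⇒ f` or `g` bent — no pair of two NON-bent cubics is
  θ-close to exactness.  Obstruction it isolates: non-bent cubics are not plateaued (capacity → 1 along the 𝔽_{2^r} pencil,
  Disproof §4).  Landed partial result: EMPTY window (1 − 2⁻¹⁰, 1) for every non-bent cubic `g` on n ≤ 28 bits
  (`nonBentBand_le_28`, tower walk).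
Composition `nearExactIsExact_of_parts : BentStub → NonBentStub → (crux unfolded)` (θ := max; symmetry of Φ for a bent `f`) and the
registered skeleton `NearExactIsExact_of : NearExactIsExact := nearExactIsExact_of_parts stub₁ stub₂` (crux BY NAME).

## What is PROVED here besides the composition (adapters that make the stubs attackable)
* `isBentD_iff_sq`: `(∃ d, Φ(d,g) = 1) ↔ ∀ x, W_g(x)² = 2ⁿ` on `m + m` bits — the stubs' bentness is the lead's `IsBentFun`.
* `bentStub_iff_dualDistanceGap`: stub₁ ⟺ `∃ c > 0 ∀ m ∀ cubic f ∀ cubic g ∀ d, W_g = 2^m(−1)^d → f = d ∨ c·2^{m+m} ≤ #{f ≠ d}`.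
* `bentValue_mul_mem`: the bent-sided cubic value set `𝒞_b = {Φ(f,g) : n even, f g cubic, g bent}` is closed under products
  (direct sums: `forrelation_directSum` on the pair AND on the dual pair), hence WINDOW AMPLIFICATION holds inside stub₁
  (`bentStub_of_window`: an empty window `(θ₁, θ₂)` of `𝒞_b` gives stub₁ with `θ = θ₁/θ₂`) — the lead's §3 lever, transplanted.
* both stubs follow from the crux (`stub₁_of_crux`, `stub₂_of_crux`): a refutation of either stub refutes the crux (SAFE cut;
  neither stub is stronger than the crux, neither restates it — probes in the strategist folder `work/SplitProbes.lean`).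
Disproof used: Disproof.lean has no `_false_without_` theorem; §4 (cubicity of BOTH sides load-bearing) is honoured — both
stubs keep `IsDegLeFun 3 f` and `IsDegLeFun 3 g`; the landed Negative witness (15/16, both sides bent) is an instance of
stub₁'s hypotheses with `Φ < 1`, consistent with `∃ θ ≥ 15/16`.
-/

set_option linter.dupNamespace false -- D-0017: single-problem summit ⇒ `QuantumAdvantage.QuantumAdvantage` by design

noncomputable section

namespace Summit.QuantumAdvantage.QuantumAdvantage.Cruxes.NearExactIsExact.BentNonbentSplit

open Finset
open Literature.Computability.QuantumComplexity
open Literature.Computability.QuantumComplexity.BuzetChailloux (signOf_sq)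
open Literature.Computability.QuantumComplexity.DerivativeWalsh (W fsum fsum_signOf_sq_of_forrelation_sq
  two_pow_mul_W_eq)
open Summit.QuantumAdvantage.QuantumAdvantage.Theses.CubicForrelation (NearExactIsExact)
open Summit.QuantumAdvantage.QuantumAdvantage.Theorems.CubicForrelation.NearExactIsExact
  (bb_exists_dual bb_forrelation_dual_eq_one bb_forrelation_eq_of_dual bb_forrelation_eq_one_iff bb_dual_unique)

/-! ## §0 Vocabulary -/

/-- `g` is **bent, witnessed by a dual**: some Boolean `d` is exactly forrelated with `g` (`Φ(d,g) = 1`).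
On `m + m` bits this is the usual bentness `W_g² ≡ 2^{m+m}` (`isBentD_iff_sq`); on an odd number of bits it is
unsatisfiable.  Spelled with `forrelation` only, so that the two stubs elaborate in the route file's imports. -/
def IsBentD {n : ℕ} (g : (Fin n → Bool) → Bool) : Prop :=
  ∃ d : (Fin n → Bool) → Bool, forrelation d g = 1

/-- The statement of the bent-side stub (child 1 of the decomposition). -/
def BentStub : Prop :=
  ∃ θ : ℝ, θ < 1 ∧ ∀ n : ℕ, Even n → ∀ f g : (Fin n → Bool) → Bool, IsDegLeFun 3 f → IsDegLeFun 3 g →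
    (∃ d : (Fin n → Bool) → Bool, forrelation d g = 1) → θ < forrelation f g → forrelation f g = 1

/-- The statement of the non-bent-side stub (child 2 of the decomposition). -/
def NonBentStub : Prop :=
  ∃ θ : ℝ, θ < 1 ∧ ∀ n : ℕ, Even n → ∀ f g : (Fin n → Bool) → Bool, IsDegLeFun 3 f → IsDegLeFun 3 g →
    θ < forrelation f g →
      (∃ d : (Fin n → Bool) → Bool, forrelation d f = 1) ∨ (∃ d : (Fin n → Bool) → Bool, forrelation d g = 1)

/-! ## §1 Symmetry and the bentness dictionary (proved) -/

/-- `Φ(f,g) = Φ(g,f)`. [folklore] -/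
theorem forrelation_comm {n : ℕ} (f g : (Fin n → Bool) → Bool) : forrelation f g = forrelation g f := by
  unfold forrelation
  congr 1
  rw [Finset.sum_comm]
  refine Finset.sum_congr rfl fun y _ => Finset.sum_congr rfl fun x _ => ?_
  rw [twist_comm]; ring

/-- `Φ(d,g) = 1 ⇒ W_g(x)² = 2ⁿ` for every `x` (Cauchy–Schwarz equality case, tree `two_pow_mul_W_eq`). [folklore] -/
theorem W_sq_of_forrelation_eq_one {n : ℕ} {d g : (Fin n → Bool) → Bool} (h : forrelation d g = 1) (x : Fin n → Bool) :
    W (fun y => signOf (g y)) x ^ 2 = (2 : ℝ) ^ n := by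
  have hS : fsum (fun x => signOf (d x)) (fun y => signOf (g y)) ^ 2 = (8 : ℝ) ^ n :=
    fsum_signOf_sq_of_forrelation_sq d g (by rw [h, one_pow])
  have hx := two_pow_mul_W_eq (fun x => signOf (d x)) (fun y => signOf (g y)) (fun x => signOf_sq (d x))
    (fun y => signOf_sq (g y)) hS x
  have hsq : ((2 : ℝ) ^ n * W (fun y => signOf (g y)) x) ^ 2 = (8 : ℝ) ^ n := by
    rw [hx, mul_pow, hS, signOf_sq, mul_one]
  have h8 : (8 : ℝ) ^ n = ((2 : ℝ) ^ n) ^ 2 * (2 : ℝ) ^ n := by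
    rw [← pow_mul, ← pow_add, show n * 2 + n = 3 * n by ring, pow_mul]; norm_num
  rw [mul_pow, h8] at hsq
  exact mul_left_cancel₀ (by positivity) hsq

/-- **Bentness dictionary** on `m + m` bits: `(∃ d, Φ(d,g) = 1) ↔ ∀ x, W_g(x)² = 2^{m+m}` — the stubs' bentness is the
lead's `IsBentFun` (← : the landed dual `bb_exists_dual` is exactly forrelated with `g`, `bb_forrelation_dual_eq_one`). [folklore] -/
theorem isBentD_iff_sq {m : ℕ} (g : (Fin (m + m) → Bool) → Bool) :
    IsBentD g ↔ ∀ x, W (fun y => signOf (g y)) x ^ 2 = (2 : ℝ) ^ (m + m) := by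
  constructor
  · rintro ⟨d, hd⟩ x
    exact W_sq_of_forrelation_eq_one hd x
  · intro hbent
    obtain ⟨d, hd⟩ := bb_exists_dual hbent
    exact ⟨d, bb_forrelation_dual_eq_one hd⟩

/-- A function exactly forrelated with `g` IS the (sign-)dual: `Φ(d,g) = 1 ⇒ W_g = 2^m (−1)^d`. [folklore] -/
theorem dual_of_forrelation_eq_one {m : ℕ} {d g : (Fin (m + m) → Bool) → Bool} (h : forrelation d g = 1) :
    ∀ x, W (fun y => signOf (g y)) x = (2 : ℝ) ^ m * signOf (d x) := by
  obtain ⟨d', hd'⟩ := bb_exists_dual (W_sq_of_forrelation_eq_one h)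
  have hdd : d = d' := (bb_forrelation_eq_one_iff d g d' hd').1 h
  subst hdd
  exact hd'

/-! ## §2 The bent stub in DISTANCE form (proved equivalence) -/

/-- **stub₁ ⟺ DualDistanceGap**: the bent-side stub holds iff there is an absolute `c > 0` such that for every `m`, every
cubic `f`, every cubic `g` with (sign-)dual `d` (`W_g = 2^m(−1)^d`): `f = d` or `#{x : f x ≠ d x} ≥ c·2^{m+m}` — "the dual of
a cubic bent function is cubic or uniformly far from RM(3)".  (`Φ(f,g) = 1 − 2·#{f ≠ d}/2^{m+m}`, landed
`bb_forrelation_eq_of_dual`; `c = (1−θ)/2`, `θ = 1 − 2c`.) [folklore] -/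
theorem bentStub_iff_dualDistanceGap :
    BentStub ↔ ∃ c : ℝ, 0 < c ∧ ∀ (m : ℕ) (f g d : (Fin (m + m) → Bool) → Bool), IsDegLeFun 3 f → IsDegLeFun 3 g →
      (∀ x, W (fun y => signOf (g y)) x = (2 : ℝ) ^ m * signOf (d x)) →
        f = d ∨ c * (2 : ℝ) ^ (m + m) ≤ ((univ.filter fun x => f x ≠ d x).card : ℝ) := by
  constructor
  · rintro ⟨θ, hθ, h⟩
    refine ⟨(1 - θ) / 2, by linarith, fun m f g d hf hg hd => ?_⟩
    by_cases hlt : θ < forrelation f g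
    · exact Or.inl ((bb_forrelation_eq_one_iff f g d hd).1
        (h (m + m) ⟨m, rfl⟩ f g hf hg ⟨d, bb_forrelation_dual_eq_one hd⟩ hlt))
    · right
      push Not at hlt
      rw [bb_forrelation_eq_of_dual f g d hd] at hlt
      have h2 : (0 : ℝ) < (2 : ℝ) ^ (m + m) := by positivity
      rw [sub_le_iff_le_add, ← sub_le_iff_le_add', mul_div_assoc] at hlt
      have := (le_div_iff₀ h2).1 (by linarith : (1 - θ) / 2 ≤ ((univ.filter fun x => f x ≠ d x).card : ℝ) / 2 ^ (m + m))
      linarith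
  · rintro ⟨c, hc, h⟩
    refine ⟨1 - 2 * min c 1, by have := min_le_left c 1; nlinarith [lt_min hc one_pos], ?_⟩
    rintro n ⟨m, rfl⟩ f g hf hg ⟨d, hdg⟩ hlt
    have hd := dual_of_forrelation_eq_one hdg
    rcases h m f g d hf hg hd with hfd | hfar
    · exact (bb_forrelation_eq_one_iff f g d hd).2 hfd
    · exfalso
      rw [bb_forrelation_eq_of_dual f g d hd] at hlt
      have h2 : (0 : ℝ) < (2 : ℝ) ^ (m + m) := by positivity
      have hmin : min c 1 * (2 : ℝ) ^ (m + m) ≤ ((univ.filter fun x => f x ≠ d x).card : ℝ) :=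
        le_trans (mul_le_mul_of_nonneg_right (min_le_left _ _) h2.le) hfar
      have hA : 2 * ((univ.filter fun x => f x ≠ d x).card : ℝ) / 2 ^ (m + m) < 2 * min c 1 := by linarith
      have hB : 2 * ((univ.filter fun x => f x ≠ d x).card : ℝ) < 2 * min c 1 * 2 ^ (m + m) :=
        (div_lt_iff₀ h2).1 hA
      have hB' : 2 * ((univ.filter fun x => f x ≠ d x).card : ℝ) < 2 * (min c 1 * 2 ^ (m + m)) := by
        rw [mul_assoc] at hB; exact hB
      linarith [hB', hmin]

/-! ## §3 Window amplification INSIDE the bent stub (proved) -/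

/-- Degree `≤ d` is preserved by direct sums `x ↦ f₁(x|₁) ⊕ f₂(x|₂)`. [cite: Carlet2020, §2.2.1 Def. 6] -/
theorem isDegLeFun_directSum {n₁ n₂ d : ℕ} {f₁ : (Fin n₁ → Bool) → Bool} {f₂ : (Fin n₂ → Bool) → Bool}
    (h₁ : IsDegLeFun d f₁) (h₂ : IsDegLeFun d f₂) :
    IsDegLeFun d (fun x : Fin (n₁ + n₂) → Bool =>
      xor (f₁ fun i => x (Fin.castAdd n₂ i)) (f₂ fun j => x (Fin.natAdd n₁ j))) := by
  obtain ⟨p₁, hp₁, hf₁⟩ := h₁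
  obtain ⟨p₂, hp₂, hf₂⟩ := h₂
  refine ⟨MvPolynomial.rename (Fin.castAdd n₂) p₁ + MvPolynomial.rename (Fin.natAdd n₁) p₂, ?_, fun x => ?_⟩
  · exact (MvPolynomial.totalDegree_add _ _).trans
      (max_le ((MvPolynomial.totalDegree_rename_le _ _).trans hp₁)
        ((MvPolynomial.totalDegree_rename_le _ _).trans hp₂))
  · show xor (f₁ _) (f₂ _) = _
    rw [hf₁, hf₂]
    simp only [polyPhase, map_add, MvPolynomial.eval_rename, Function.comp_def]
    generalize MvPolynomial.eval _ p₁ = a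
    generalize MvPolynomial.eval _ p₂ = b
    revert a b
    decide

/-- The **bent-sided cubic value set** `𝒞_b := {Φ(f,g) : n even, f g cubic, g bent (by a dual)}`. -/
def BentValueSet : Set ℝ :=
  {ρ | ∃ n : ℕ, Even n ∧ ∃ f g : (Fin n → Bool) → Bool, IsDegLeFun 3 f ∧ IsDegLeFun 3 g ∧ IsBentD g ∧ forrelation f g = ρ}

/-- **`𝒞_b · 𝒞_b ⊆ 𝒞_b`**: direct sums multiply `Φ` (`forrelation_directSum`), preserve degrees and evenness, and the direct sum
of two bent functions is bent — its dual is the direct sum of the duals, again by `forrelation_directSum` (`1·1 = 1`). [folklore] -/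
theorem bentValue_mul_mem {ρ₁ ρ₂ : ℝ} (h₁ : ρ₁ ∈ BentValueSet) (h₂ : ρ₂ ∈ BentValueSet) : ρ₁ * ρ₂ ∈ BentValueSet := by
  obtain ⟨n₁, hn₁, f₁, g₁, hf₁, hg₁, ⟨d₁, hd₁⟩, rfl⟩ := h₁
  obtain ⟨n₂, hn₂, f₂, g₂, hf₂, hg₂, ⟨d₂, hd₂⟩, rfl⟩ := h₂
  refine ⟨n₁ + n₂, hn₁.add hn₂, _, _, isDegLeFun_directSum hf₁ hf₂, isDegLeFun_directSum hg₁ hg₂, ?_,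
    forrelation_directSum f₁ g₁ f₂ g₂⟩
  exact ⟨_, by rw [forrelation_directSum d₁ g₁ d₂ g₂, hd₁, hd₂, one_mul]⟩

/-- Powers stay in `𝒞_b`. [folklore] -/
theorem bentValue_pow_succ_mem {ρ : ℝ} (h : ρ ∈ BentValueSet) : ∀ k : ℕ, ρ ^ (k + 1) ∈ BentValueSet
  | 0 => by simpa using h
  | k + 1 => by rw [pow_succ]; exact bentValue_mul_mem (bentValue_pow_succ_mem h k) h

/-- `𝒞_b ⊆ (−∞, 1]` (for bent `g`, `Φ = 1 − 2·dist/2ⁿ`). [folklore] -/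
theorem bentValue_le_one {ρ : ℝ} (h : ρ ∈ BentValueSet) : ρ ≤ 1 := by
  obtain ⟨n, ⟨m, rfl⟩, f, g, -, -, ⟨d, hdg⟩, rfl⟩ := h
  rw [bb_forrelation_eq_of_dual f g d (dual_of_forrelation_eq_one hdg)]
  have h2 : (0 : ℝ) < (2 : ℝ) ^ (m + m) := by positivity
  have : (0 : ℝ) ≤ 2 * ((univ.filter fun x => f x ≠ d x).card : ℝ) / 2 ^ (m + m) := by positivity
  linarith

/-- **Window amplification inside the bent stub**: if no BENT-sided cubic pair has `Φ ∈ (θ₁, θ₂)` (`0 < θ₁ < θ₂ ≤ 1`) then none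
has `Φ ∈ (θ₁/θ₂, 1)` — the powers of a hypothetical value `ρ` in that interval stay above `θ₁` forever (each is a bent-sided value,
hence `≥ θ₂`, and the next is `≥ ρθ₂ > θ₁`), contradicting `ρ^k → 0`.  Verbatim the lead's `window_amplification`, run in the
sub-monoid `𝒞_b`. [folklore] -/
theorem bentWindow_amplification {θ₁ θ₂ : ℝ} (h0 : 0 < θ₁) (h12 : θ₁ < θ₂) (h2 : θ₂ ≤ 1)
    (hwin : ∀ ρ ∈ BentValueSet, ρ ≤ θ₁ ∨ θ₂ ≤ ρ) {ρ : ℝ} (hρ : ρ ∈ BentValueSet) (hlt : θ₁ / θ₂ < ρ) : ρ = 1 := by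
  have hθ₂ : 0 < θ₂ := h0.trans h12
  have hρ1 : ρ ≤ 1 := bentValue_le_one hρ
  by_contra hne
  have hρlt1 : ρ < 1 := lt_of_le_of_ne hρ1 hne
  have hq : 0 < θ₁ / θ₂ := div_pos h0 hθ₂
  have hρpos : 0 < ρ := hq.trans hlt
  have hall : ∀ k : ℕ, θ₁ < ρ ^ (k + 1) := by
    intro k
    induction k with
    | zero =>
      rw [zero_add, pow_one]
      calc θ₁ ≤ θ₁ / θ₂ := by rw [le_div_iff₀ hθ₂]; exact mul_le_of_le_one_right h0.le h2
        _ < ρ := hlt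
    | succ k ih =>
      rcases hwin _ (bentValue_pow_succ_mem hρ k) with hle | hge
      · exact absurd hle (not_le.2 ih)
      · rw [pow_succ]
        calc θ₁ = θ₂ * (θ₁ / θ₂) := by field_simp
          _ < θ₂ * ρ := mul_lt_mul_of_pos_left hlt hθ₂
          _ ≤ ρ ^ (k + 1) * ρ := mul_le_mul_of_nonneg_right hge hρpos.le
  obtain ⟨k, hk⟩ := exists_pow_lt_of_lt_one h0 hρlt1
  have hk' := hall k
  have hmono : ρ ^ (k + 1) ≤ ρ ^ k := pow_le_pow_of_le_one hρpos.le hρ1 (Nat.le_succ k)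
  linarith

/-- **Adapter**: an empty window `(θ₁, θ₂)` of the BENT-sided value set gives the bent stub with `θ = θ₁/θ₂`. [folklore] -/
theorem bentStub_of_window {θ₁ θ₂ : ℝ} (h0 : 0 < θ₁) (h12 : θ₁ < θ₂) (h2 : θ₂ ≤ 1)
    (hwin : ∀ ρ ∈ BentValueSet, ρ ≤ θ₁ ∨ θ₂ ≤ ρ) : BentStub := by
  have hθ₂ : 0 < θ₂ := h0.trans h12
  refine ⟨θ₁ / θ₂, (div_lt_one hθ₂).2 h12, fun n hn f g hf hg hb hlt => ?_⟩
  exact bentWindow_amplification h0 h12 h2 hwin ⟨n, hn, f, g, hf, hg, hb, rfl⟩ hlt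

/-! ## §4 Registered stubs (2 — the two children of the decomposition; both OPEN, both consequences of the crux) -/

/-- **stub_nearExactBentIsExact** (child 1, the BENT side; OPEN, size XL; = DualDistanceGap / BentSidedIsolation of the crux-idea
cards two-sided-almost-bentness / low-rank-dyadic-rigidity; the live core `stub_bentBandLarge` without its side conditions).
There is an absolute `θ < 1` such that for every even `n`, every cubic `f` and every cubic `g` that is bent (some `d` has
`Φ(d,g) = 1`), `Φ(f,g) > θ ⇒ Φ(f,g) = 1`.  Equivalently (`bentStub_iff_dualDistanceGap`): the dual of a cubic bent function is
cubic or at relative distance `≥ c` from every cubic.  Why plausible: true for MM-shaped / almost-MM / low-rank-spanned / deg g̃ ≤ 11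
(all landed); every known high-degree dual (Gold-type MM, Hou-extremal) is ≥ 1/32-far from RM(3).  Why it might fail: cubic bent
functions OUTSIDE MM-shape whose duals are `cubic ⊕ 1_A` with codim A → ∞ (the n = 10/16 residue pattern, which MM abandons at
codim ≤ 5).  Necessarily θ ≥ 15/16 (landed witness, both sides bent). -/
theorem stub_nearExactBentIsExact :
    ∃ θ : ℝ, θ < 1 ∧ ∀ n : ℕ, Even n → ∀ f g : (Fin n → Bool) → Bool, IsDegLeFun 3 f → IsDegLeFun 3 g →
      (∃ d : (Fin n → Bool) → Bool, forrelation d g = 1) → θ < forrelation f g → forrelation f g = 1 := by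
  sorry

/-- **stub_nearExactIsBent** (child 2, the NON-BENT side; OPEN, size XL, HARDEST by the leads' ranking; the live core
`stub_nonBentBand` without its side conditions).  There is an absolute `θ < 1` such that every cubic pair on an even number of bits
with `Φ(f,g) > θ` has `f` bent or `g` bent (by a dual) — no pair of two NON-bent cubics is θ-close to exactness.  Why plausible: the
window `(1 − 2⁻¹⁰, 1)` contains no pair with a non-bent cubic `g` for any n ≤ 28 (landed tower walk `nonBentBand_le_28`); non-bent
records against cubic partners are 13/16 (n = 8), 57/64 (n = 12), < 7/8 (n = 10).  Why it might fail: a non-MM near-bent (non-bent)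
cubic family whose Walsh SIGN pattern is cubic off a vanishing fraction (Disproof §5: an identity of unbounded degree between two
cubic objects); beyond n = 28 the tower's costs tend to 0 and type-O cubics on n ≥ 30 were never searched. -/
theorem stub_nearExactIsBent :
    ∃ θ : ℝ, θ < 1 ∧ ∀ n : ℕ, Even n → ∀ f g : (Fin n → Bool) → Bool, IsDegLeFun 3 f → IsDegLeFun 3 g →
      θ < forrelation f g →
        (∃ d : (Fin n → Bool) → Bool, forrelation d f = 1) ∨ (∃ d : (Fin n → Bool) → Bool, forrelation d g = 1) := by
  sorry

/-! ## §5 Composition (sorry-free): the two stub STATEMENTS imply the crux -/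

/-- **The composition, as a closed implication**: `BentStub → NonBentStub → (the crux, unfolded)`.  Take `θ := max θ₁ θ₂`; above
`θ` one side is bent (stub₂); if it is `g`, stub₁ applies; if it is `f`, stub₁ applies to the swapped pair `(g, f)`, which has the
same forrelation (`forrelation_comm`).  The conclusion is the crux UNFOLDED (definitionally `NearExactIsExact`, `Iff.rfl`), so that the
only theorem of this file concluding the route decl BY NAME is the registered skeleton `NearExactIsExact_of` below (skeleton lint:
one candidate, no hypotheses outside the declared stubs). [folklore] -/
theorem nearExactIsExact_of_parts (hB : BentStub) (hN : NonBentStub) :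
    ∃ θ : ℝ, θ < 1 ∧ ∀ n : ℕ, Even n → ∀ f g : (Fin n → Bool) → Bool, IsDegLeFun 3 f → IsDegLeFun 3 g →
      θ < forrelation f g → forrelation f g = 1 := by
  obtain ⟨θ₁, hθ₁, hB⟩ := hB
  obtain ⟨θ₂, hθ₂, hN⟩ := hN
  refine ⟨max θ₁ θ₂, max_lt hθ₁ hθ₂, fun n hn f g hf hg hlt => ?_⟩
  have h1 : θ₁ < forrelation f g := lt_of_le_of_lt (le_max_left _ _) hlt
  have h2 : θ₂ < forrelation f g := lt_of_le_of_lt (le_max_right _ _) hlt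
  rcases hN n hn f g hf hg h2 with hfb | hgb
  · rw [forrelation_comm] at h1 ⊢
    exact hB n hn g f hg hf hfb h1
  · exact hB n hn f g hf hg hgb h1

/-- **The skeleton**: the crux BY NAME from the two (sorried) stubs (proof-of-item modulo `sorryAx`; the stub statements ARE
`BentStub` / `NonBentStub`, definitionally). -/
theorem NearExactIsExact_of : Summit.QuantumAdvantage.QuantumAdvantage.Theses.CubicForrelation.NearExactIsExact :=
  nearExactIsExact_of_parts stub_nearExactBentIsExact stub_nearExactIsBent

/-! ## §6 Safety (sorry-free): both stubs are CONSEQUENCES of the crux, and the cut is an equivalence -/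

/-- stub₁ follows from the crux (drop the bentness hypothesis). [folklore] -/
theorem stub₁_of_crux (h : NearExactIsExact) : type_of% stub_nearExactBentIsExact := by
  obtain ⟨θ, hθ, h⟩ := h
  exact ⟨θ, hθ, fun n hn f g hf hg _ hlt => h n hn f g hf hg hlt⟩

/-- stub₂ follows from the crux (an exact pair has `g` bent with dual `f`). [folklore] -/
theorem stub₂_of_crux (h : NearExactIsExact) : type_of% stub_nearExactIsBent := by
  obtain ⟨θ, hθ, h⟩ := h
  exact ⟨θ, hθ, fun n hn f g hf hg hlt => Or.inr ⟨f, h n hn f g hf hg hlt⟩⟩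

/-- The crux is EQUIVALENT to the conjunction of the two stub statements. [folklore] -/
theorem nearExactIsExact_iff_stubs :
    NearExactIsExact ↔ (type_of% stub_nearExactBentIsExact) ∧ (type_of% stub_nearExactIsBent) :=
  ⟨fun h => ⟨stub₁_of_crux h, stub₂_of_crux h⟩, fun h => nearExactIsExact_of_parts h.1 h.2⟩

/-- The stub statements are literally `BentStub` / `NonBentStub` (definitional). -/
example : (type_of% stub_nearExactBentIsExact) = BentStub := rfl
example : (type_of% stub_nearExactIsBent) = NonBentStub := rfl

end Summit.QuantumAdvantage.QuantumAdvantage.Cruxes.NearExactIsExact.BentNonbentSplit
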